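import Summits.CriticalPhenomena.PercolationContinuityZ3.Theorems.PercNearOneGluingNoHeavyLowerTailQ44SingleSourceEMonoA
import Summits.CriticalPhenomena.PercolationContinuityZ3.Theorems.PercNearOneGluingNoHeavyLowerTailFourPointAtoms
import HarnessLib
import HarnessLib.Audit.Tags

/-!
# The complementary-pair packing row `U` (all `n`) from its one-bond pencil: MIX-U and PENCIL-CONCAVITY sockets

Support file for crux `stmt-CriticalPhenomena-4575` (master-family programme, row `U` of `prim-bnk-1` gen 34 §8 / gen 35:
`c₀c₁₄ ≥ c₁₁·Σ_{D°} c + ½·Σ_{darts} c_p c_t`, OPEN for all `n`), seat `prim-bnk-1` gen 37; memo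
`run/shared/lean/prim/prim-l12/FROM-prim-bnk-1-gen37-POLAR-GLADKOV.md` §4.  Parallel to `ConjW.law_nonneg_of_mixW` (p6 g25, row `Q44`).

Bond percolation `μ_w = prodBernoulli w` on the pairs of `Fin n`, marked vertices `a b c y`, cells `cell w a b c y i` (`FourPointAtoms.pat4`:
`0 a|b|c|y, 2 a|by|c, 3 a|bc|y, 4 ay|b|c, 5 ac|b|y, 7 a|bcy, 8 ay|bc, 9 ac|by, 10 acy|b, 11 ab|cy, 12 aby|c, 13 abc|y, 14 abcy`).  The row, in the
integer form of `TwoCopyMono.packU_of_goodKernel`, is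
  `2·U = 2c₀c₁₄ − 2c₁₁(c₂+c₃+c₄+c₅+c₈+c₉) − (c₂c₁₀ + c₂c₁₃ + c₃c₁₀ + c₃c₁₂ + c₄c₇ + c₄c₁₃ + c₅c₇ + c₅c₁₂) ≥ 0`.

With the bilinear form `PackUPencil.bil w w'` of `2·U` in two weightings (`law w = bil w w`) and `w₀ = w[e↦0]`, `w₁ = w[e↦1]`:
* `law_oneBond` — the one-bond pencil `law w = (1−t)²B(w₀,w₀) + (1−t)t B(w₀,w₁) + t(1−t) B(w₁,w₀) + t²B(w₁,w₁)`, `t = w e`;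
* `MixU` — **MIX-U**: `0 ≤ B(w₀,w₁) + B(w₁,w₀)` for every pair `e = s(x,z)` whose end `x` is surely joined to `a` in `w₀`
  (the symmetrised one-bond term of `prim-bnk-1` gen 35 §1; census there: 0 failures in 3 372 exact pencils; implied by `GoodKernel kerU`);
* `PencilConcaveU` — **PC-U** (Gladkov concavity of the pencil): `B(w₀,w₀) + B(w₁,w₁) ≤ B(w₀,w₁) + B(w₁,w₀)`, i.e. the `t²`-coefficient
  `½·δᵀ K_U δ` (`δ = law(G/e) − law(G∖e)`) is `≤ 0`.  Census (memo §4): 0 failures on all 41 M (multigraph, edge) pairs with ≤ 6 vertices / ≤ 9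
  edges and 7 / ≤ 8 at weight ½, and in 6 178 random-weight pencils; the analogous statement for `2·Q44` is FALSE (explicit, memo §4).
  PC-U is the stronger hypothesis (given the row on the two end graphs), but it is a statement about ONE vector `δ`;
* `pencil_step_mix`, `pencil_step_concave`, `law_nonneg_of_frozen` (if `P(a~b), P(a~c), P(a~y) ∈ {0,1}` all fifteen side products vanish),
  `law_nonneg_of_mixU` (**MIX-U ⟹ 2·U ≥ 0 on every finite weighted graph**), `law_nonneg_of_pencilConcaveU` (**PC-U ⟹ the same**; induction on
  the number of fractional pairs, as in `Q44b.row_nonneg_of_pencilConcave`), and `packU_of_mixU` / `packU_of_pencilConcaveU` (the row in the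
  literal cell form of `TwoCopyMono.packU_of_goodKernel`).
Definitions (`bil`, `law`, `MixU`, `PencilConcaveU`) and theorems; no named facts, no sorries, standard axioms; the two `@[conjecture]`
definitions are obligations of this programme (census-true, unproved), used only as explicit hypotheses.
-/

noncomputable section

namespace Summit.CriticalPhenomena.PercolationContinuityZ3.Theorems

namespace PackUPencil

open MeasureTheory Set Literature.Probability.LatticeModels Literature.Probability.Percolation
open FourPointAtoms
open Summit.CriticalPhenomena.PercolationContinuityZ3.Cruxes.AdditiveGluing.TieLine.ConnAtoms
open scoped Classical

variable {n : ℕ}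

/-! ### The bilinear form of `2·U` and the law -/

/-- The bilinear form of `2·U` in two weightings (copy 1 under `w`, copy 2 under `w'`): goods `2·P_w(a|b|c|y)·P_{w'}(abcy)`, minus twice the six
`B`-pairs `(ab|cy under w; D° under w')`, minus the eight darts `(crossing pair under w; three-block under w')`. [this work] -/
def bil (w w' : Sym2 (Fin n) → unitInterval) (a b c y : Fin n) : ℝ :=
  2 * (cell w a b c y 0 * cell w' a b c y 14) -
    2 * (cell w a b c y 11 * (cell w' a b c y 2 + cell w' a b c y 3 + cell w' a b c y 4 + cell w' a b c y 5 + cell w' a b c y 8 +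
      cell w' a b c y 9)) -
    (cell w a b c y 2 * cell w' a b c y 10 + cell w a b c y 2 * cell w' a b c y 13 + cell w a b c y 3 * cell w' a b c y 10 +
      cell w a b c y 3 * cell w' a b c y 12 + cell w a b c y 4 * cell w' a b c y 7 + cell w a b c y 4 * cell w' a b c y 13 +
      cell w a b c y 5 * cell w' a b c y 7 + cell w a b c y 5 * cell w' a b c y 12)

/-- `2·U` as a number: `law w = bil w w` (row `U`: `≥ 0`, open). [this work] -/
def law (w : Sym2 (Fin n) → unitInterval) (a b c y : Fin n) : ℝ := bil w w a b c y

/-- **MIX-U (law level)**: for every weighting `w` and every pair `s(x,z)` (`x ≠ z`) whose end `x` is surely joined to `a` in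
`w₀ = w[s(x,z)↦0]`: `0 ≤ B(w₀,w₁) + B(w₁,w₀)` with `w₁ = w[s(x,z)↦1]`.  OPEN; implied by `TwoCopyMono.GoodKernel kerU`. [this work] -/
@[conjecture] def MixU (n : ℕ) (a b c y : Fin n) : Prop :=
  ∀ (w : Sym2 (Fin n) → unitInterval) (x z : Fin n), x ≠ z →
    Q44b.sureJoined (Function.update w s(x, z) 0) a x →
      0 ≤ bil (Function.update w s(x, z) 0) (Function.update w s(x, z) 1) a b c y +
        bil (Function.update w s(x, z) 1) (Function.update w s(x, z) 0) a b c y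

/-- **PC-U (Gladkov concavity of the `U`-pencil, law level)**: for every weighting `w` and every pair `s(x,z)` (`x ≠ z`) whose end `x` is
surely joined to `a` in `w₀`: `B(w₀,w₀) + B(w₁,w₁) ≤ B(w₀,w₁) + B(w₁,w₀)`, i.e. `δᵀK_Uδ ≤ 0` for `δ = law(G/e) − law(G∖e)`: the one-bond
pencil of `2·U` is concave.  OPEN (census: memo gen 37 §4). [this work] -/
@[conjecture] def PencilConcaveU (n : ℕ) (a b c y : Fin n) : Prop :=
  ∀ (w : Sym2 (Fin n) → unitInterval) (x z : Fin n), x ≠ z →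
    Q44b.sureJoined (Function.update w s(x, z) 0) a x →
      bil (Function.update w s(x, z) 0) (Function.update w s(x, z) 0) a b c y +
          bil (Function.update w s(x, z) 1) (Function.update w s(x, z) 1) a b c y ≤
        bil (Function.update w s(x, z) 0) (Function.update w s(x, z) 1) a b c y +
          bil (Function.update w s(x, z) 1) (Function.update w s(x, z) 0) a b c y

/-! ### The pencil -/

/-- One-bond expansion of the law: with `t = w e`, `w₀ = w[e↦0]`, `w₁ = w[e↦1]`,
`law w = (1−t)² B(w₀,w₀) + (1−t)t B(w₀,w₁) + t(1−t) B(w₁,w₀) + t² B(w₁,w₁)`. [this work] -/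
theorem law_oneBond (w : Sym2 (Fin n) → unitInterval) (e : Sym2 (Fin n)) (a b c y : Fin n) :
    law w a b c y =
      (1 - (w e : ℝ)) * (1 - (w e : ℝ)) * bil (Function.update w e 0) (Function.update w e 0) a b c y +
        (1 - (w e : ℝ)) * (w e : ℝ) * bil (Function.update w e 0) (Function.update w e 1) a b c y +
        (w e : ℝ) * (1 - (w e : ℝ)) * bil (Function.update w e 1) (Function.update w e 0) a b c y +
        (w e : ℝ) * (w e : ℝ) * bil (Function.update w e 1) (Function.update w e 1) a b c y := by
  unfold law bil
  rw [SingleSourceLaw.cell_oneBond w e a b c y 0, SingleSourceLaw.cell_oneBond w e a b c y 2, SingleSourceLaw.cell_oneBond w e a b c y 3,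
    SingleSourceLaw.cell_oneBond w e a b c y 4, SingleSourceLaw.cell_oneBond w e a b c y 5, SingleSourceLaw.cell_oneBond w e a b c y 7,
    SingleSourceLaw.cell_oneBond w e a b c y 8, SingleSourceLaw.cell_oneBond w e a b c y 9, SingleSourceLaw.cell_oneBond w e a b c y 10,
    SingleSourceLaw.cell_oneBond w e a b c y 11, SingleSourceLaw.cell_oneBond w e a b c y 12, SingleSourceLaw.cell_oneBond w e a b c y 13,
    SingleSourceLaw.cell_oneBond w e a b c y 14]
  ring

/-- **Pencil step under a nonnegative mixed term**: `(1−t)²B₀ + t(1−t)X + t²B₂ ≥ 0` on `[0,1]` as soon as `B₀, B₂, X ≥ 0`. [this work] -/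
theorem pencil_step_mix (w : Sym2 (Fin n) → unitInterval) (e : Sym2 (Fin n)) (a b c y : Fin n)
    (h0 : 0 ≤ law (Function.update w e 0) a b c y) (h1 : 0 ≤ law (Function.update w e 1) a b c y)
    (hX : 0 ≤ bil (Function.update w e 0) (Function.update w e 1) a b c y +
      bil (Function.update w e 1) (Function.update w e 0) a b c y) :
    0 ≤ law w a b c y := by
  rw [law_oneBond w e]
  unfold law at h0 h1
  set t : ℝ := (w e : ℝ)
  have ht0 : 0 ≤ t := unitInterval.nonneg (w e)
  have ht1 : t ≤ 1 := unitInterval.le_one (w e)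
  set B0 := bil (Function.update w e 0) (Function.update w e 0) a b c y
  set B2 := bil (Function.update w e 1) (Function.update w e 1) a b c y
  set B01 := bil (Function.update w e 0) (Function.update w e 1) a b c y
  set B10 := bil (Function.update w e 1) (Function.update w e 0) a b c y
  have hmix : 0 ≤ (1 - t) * t * (B01 + B10) := mul_nonneg (mul_nonneg (by linarith) ht0) hX
  have hA : 0 ≤ (1 - t) * (1 - t) * B0 := mul_nonneg (mul_nonneg (by linarith) (by linarith)) h0
  have hB : 0 ≤ t * t * B2 := mul_nonneg (mul_nonneg ht0 ht0) h1
  linarith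

/-- **Pencil step under concavity**: if the two end values are `≥ 0` and the pencil is concave (`B₀ + B₂ ≤ X`), the law is `≥ 0`
(a concave function on `[0,1]` is at least the minimum of its end values). [this work] -/
theorem pencil_step_concave (w : Sym2 (Fin n) → unitInterval) (e : Sym2 (Fin n)) (a b c y : Fin n)
    (h0 : 0 ≤ law (Function.update w e 0) a b c y) (h1 : 0 ≤ law (Function.update w e 1) a b c y)
    (hC : bil (Function.update w e 0) (Function.update w e 0) a b c y + bil (Function.update w e 1) (Function.update w e 1) a b c y ≤
      bil (Function.update w e 0) (Function.update w e 1) a b c y + bil (Function.update w e 1) (Function.update w e 0) a b c y) :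
    0 ≤ law w a b c y := by
  refine pencil_step_mix w e a b c y h0 h1 ?_
  unfold law at h0 h1
  linarith

/-! ### Frozen cluster of `a`: every side product vanishes -/

/-- **Frozen cluster ⇒ the sides vanish and `law ≥ 0`**: if `P(a~b), P(a~c), P(a~y) ∈ {0,1}` then each of the six `B`-pairs and each of
the eight darts has one factor joining `a` to a marked point `j` and the other separating them (`j = b` for `(11;2),(11;3),(11;4),(11;5),
(11;8),(11;9),(13;2),(12;3),(13;4),(12;5)`, `j = c` for `(10;2),(10;3),(5;7)`, `j = y` for `(4;7)`), so all side products vanish and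
`law = 2·P(a|b|c|y)·P(abcy) ≥ 0`. [this work] -/
theorem law_nonneg_of_zero_one (w : Sym2 (Fin n) → unitInterval) (a b c y : Fin n)
    (hb : (prodBernoulli w).real (openConn a b) = 0 ∨ (prodBernoulli w).real (openConn a b) = 1)
    (hc : (prodBernoulli w).real (openConn a c) = 0 ∨ (prodBernoulli w).real (openConn a c) = 1)
    (hy : (prodBernoulli w).real (openConn a y) = 0 ∨ (prodBernoulli w).real (openConn a y) = 1) :
    0 ≤ law w a b c y := by
  have e112 := SingleSourceLaw.cell_mul_cell_eq_zero w a b c y 11 2 1 (by decide) (by decide) hb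
  have e113 := SingleSourceLaw.cell_mul_cell_eq_zero w a b c y 11 3 1 (by decide) (by decide) hb
  have e114 := SingleSourceLaw.cell_mul_cell_eq_zero w a b c y 11 4 1 (by decide) (by decide) hb
  have e115 := SingleSourceLaw.cell_mul_cell_eq_zero w a b c y 11 5 1 (by decide) (by decide) hb
  have e118 := SingleSourceLaw.cell_mul_cell_eq_zero w a b c y 11 8 1 (by decide) (by decide) hb
  have e119 := SingleSourceLaw.cell_mul_cell_eq_zero w a b c y 11 9 1 (by decide) (by decide) hb
  have e102 := SingleSourceLaw.cell_mul_cell_eq_zero w a b c y 10 2 2 (by decide) (by decide) hc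
  have e132 := SingleSourceLaw.cell_mul_cell_eq_zero w a b c y 13 2 1 (by decide) (by decide) hb
  have e103 := SingleSourceLaw.cell_mul_cell_eq_zero w a b c y 10 3 2 (by decide) (by decide) hc
  have e123 := SingleSourceLaw.cell_mul_cell_eq_zero w a b c y 12 3 1 (by decide) (by decide) hb
  have e47 := SingleSourceLaw.cell_mul_cell_eq_zero w a b c y 4 7 3 (by decide) (by decide) hy
  have e134 := SingleSourceLaw.cell_mul_cell_eq_zero w a b c y 13 4 1 (by decide) (by decide) hb
  have e57 := SingleSourceLaw.cell_mul_cell_eq_zero w a b c y 5 7 2 (by decide) (by decide) hc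
  have e125 := SingleSourceLaw.cell_mul_cell_eq_zero w a b c y 12 5 1 (by decide) (by decide) hb
  have hg : 0 ≤ cell w a b c y 0 * cell w a b c y 14 := mul_nonneg (cell_nonneg w a b c y 0) (cell_nonneg w a b c y 14)
  unfold law bil
  nlinarith [e112, e113, e114, e115, e118, e119, e102, e132, e103, e123, e47, e134, e57, e125, hg]

/-- **Frozen cluster ⇒ `law ≥ 0`.** [this work] -/
theorem law_nonneg_of_frozen (w : Sym2 (Fin n) → unitInterval) (a b c y : Fin n)
    (hfro : ∀ x z : Fin n, x ≠ z → Q44b.sureJoined w a x → (w s(x, z) = 0 ∨ w s(x, z) = 1)) :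
    0 ≤ law w a b c y :=
  law_nonneg_of_zero_one w a b c y (Q44b.real_openConn_zero_or_one w a hfro b)
    (Q44b.real_openConn_zero_or_one w a hfro c) (Q44b.real_openConn_zero_or_one w a hfro y)

/-! ### The induction on the number of fractional pairs -/

/-- The induction, abstracted over the step hypothesis at pairs of `a`'s sure cluster. [this work] -/
theorem law_nonneg_of_step (a b c y : Fin n)
    (hstep : ∀ (w : Sym2 (Fin n) → unitInterval) (x z : Fin n), x ≠ z → Q44b.sureJoined (Function.update w s(x, z) 0) a x →
      0 ≤ law (Function.update w s(x, z) 0) a b c y → 0 ≤ law (Function.update w s(x, z) 1) a b c y → 0 ≤ law w a b c y)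
    (w : Sym2 (Fin n) → unitInterval) : 0 ≤ law w a b c y := by
  suffices H : ∀ (k : ℕ) (w : Sym2 (Fin n) → unitInterval), (Q44b.fracPairs w).card ≤ k → 0 ≤ law w a b c y from
    H _ w le_rfl
  intro k
  induction k with
  | zero =>
    intro w hw
    have hfro : ∀ x z : Fin n, x ≠ z → Q44b.sureJoined w a x → (w s(x, z) = 0 ∨ w s(x, z) = 1) := by
      intro x z _ _
      by_contra hne
      push Not at hne
      have : s(x, z) ∈ Q44b.fracPairs w := by
        simp only [Q44b.fracPairs, Finset.mem_filter, Finset.mem_univ, true_and]; exact hne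
      have hpos : 0 < (Q44b.fracPairs w).card := Finset.card_pos.2 ⟨_, this⟩
      omega
    exact law_nonneg_of_frozen w a b c y hfro
  | succ k ih =>
    intro w hw
    by_cases hex : ∃ x z : Fin n, x ≠ z ∧ Q44b.sureJoined w a x ∧ (w s(x, z) ≠ 0 ∧ w s(x, z) ≠ 1)
    · obtain ⟨x, z, hxz, hsure, hfrac⟩ := hex
      have hlt0 := Finset.card_lt_card (Q44b.fracPairs_update_ssubset w hfrac 0 (Or.inl rfl))
      have hlt1 := Finset.card_lt_card (Q44b.fracPairs_update_ssubset w hfrac 1 (Or.inr rfl))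
      have h0 : 0 ≤ law (Function.update w s(x, z) 0) a b c y := ih _ (by omega)
      have h1 : 0 ≤ law (Function.update w s(x, z) 1) a b c y := ih _ (by omega)
      exact hstep w x z hxz (Q44b.sureJoined_update_zero w hfrac.2 hsure) h0 h1
    · push Not at hex
      have hfro : ∀ x z : Fin n, x ≠ z → Q44b.sureJoined w a x → (w s(x, z) = 0 ∨ w s(x, z) = 1) := by
        intro x z hxz hs
        by_cases h0 : w s(x, z) = 0
        · exact Or.inl h0
        · exact Or.inr (hex x z hxz hs h0)
      exact law_nonneg_of_frozen w a b c y hfro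

/-- **Row `U` from MIX-U, all `n`**: `MixU ⟹ 0 ≤ law w = 2·U` for every weighting `w` on the pairs of `Fin n`. [this work] -/
theorem law_nonneg_of_mixU (a b c y : Fin n) (hM : MixU n a b c y) (w : Sym2 (Fin n) → unitInterval) : 0 ≤ law w a b c y :=
  law_nonneg_of_step a b c y (fun w x z hxz hs h0 h1 => pencil_step_mix w s(x, z) a b c y h0 h1 (hM w x z hxz hs)) w

/-- **Row `U` from pencil concavity, all `n`**: `PencilConcaveU ⟹ 0 ≤ law w = 2·U` for every weighting (Gladkov's minimum-principle
induction: a concave pencil is at least the minimum of its two end rows). [this work] -/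
theorem law_nonneg_of_pencilConcaveU (a b c y : Fin n) (hC : PencilConcaveU n a b c y) (w : Sym2 (Fin n) → unitInterval) :
    0 ≤ law w a b c y :=
  law_nonneg_of_step a b c y (fun w x z hxz hs h0 h1 => pencil_step_concave w s(x, z) a b c y h0 h1 (hC w x z hxz hs)) w

/-- **Row `U` from MIX-U, in the literal cell form of `TwoCopyMono.packU_of_goodKernel`.** [this work] -/
theorem packU_of_mixU (a b c y : Fin n) (hM : MixU n a b c y) (w : Sym2 (Fin n) → unitInterval) :
    2 * (cell w a b c y 11 * (cell w a b c y 2 + cell w a b c y 3 + cell w a b c y 4 + cell w a b c y 5 + cell w a b c y 8 +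
        cell w a b c y 9)) +
      (cell w a b c y 2 * (cell w a b c y 10 + cell w a b c y 13) + cell w a b c y 3 * (cell w a b c y 10 + cell w a b c y 12) +
        cell w a b c y 4 * (cell w a b c y 7 + cell w a b c y 13) + cell w a b c y 5 * (cell w a b c y 7 + cell w a b c y 12)) ≤
      2 * (cell w a b c y 0 * cell w a b c y 14) := by
  have h := law_nonneg_of_mixU a b c y hM w
  unfold law bil at h
  linarith

/-- **Row `U` from pencil concavity, in the literal cell form of `TwoCopyMono.packU_of_goodKernel`.** [this work] -/
theorem packU_of_pencilConcaveU (a b c y : Fin n) (hC : PencilConcaveU n a b c y) (w : Sym2 (Fin n) → unitInterval) :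
    2 * (cell w a b c y 11 * (cell w a b c y 2 + cell w a b c y 3 + cell w a b c y 4 + cell w a b c y 5 + cell w a b c y 8 +
        cell w a b c y 9)) +
      (cell w a b c y 2 * (cell w a b c y 10 + cell w a b c y 13) + cell w a b c y 3 * (cell w a b c y 10 + cell w a b c y 12) +
        cell w a b c y 4 * (cell w a b c y 7 + cell w a b c y 13) + cell w a b c y 5 * (cell w a b c y 7 + cell w a b c y 12)) ≤
      2 * (cell w a b c y 0 * cell w a b c y 14) := by
  have h := law_nonneg_of_pencilConcaveU a b c y hC w
  unfold law bil at h
  linarith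

end PackUPencil

end Summit.CriticalPhenomena.PercolationContinuityZ3.Theorems

end
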